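import Summits.CriticalPhenomena.PercolationContinuityZ3.Theorems.PercNearOneGluingNoHeavyQuantFarSupportCert
import HarnessLib

/-!
# FAR beyond trees: reachability in a HAIRY CYCLE (cycle through the observer with pendant relays) is read off the arcs

builds on p205010 (kernel theorem, internal audit signed; external expert review pending)

Support file (`--supports stmt-CriticalPhenomena-4575`), seat `prim-cert-1` (gen 18); QUANT lane rung R8, front "FAR beyond trees" (lead g20):
the first cyclic family of `Quant.FarRelayRow` is the RING / HAIRY CYCLE — a cycle `c₀ = o, c₁, …, c_{L−1}, c₀` through the observer with
pendant edges ("hairs") `s(c_{b_k}, t_k)` to relay tips `t_k`.  This file is the combinatorial half of the transfer of FAR from the sun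
graphs (`…QuantFarSunCert`) to every hairy cycle: in a configuration `ω` all of whose open non-loop pairs are cycle or hair edges,

* `HairyCycle.openWalk_invariant` — along an open walk from `o` every visited cycle vertex `c_i` satisfies
  `RC ω i := (all cycle edges e_0 … e_{i−1} open) ∨ (all cycle edges e_i … e_{L−1} open)` (reached clockwise or counter-clockwise),
  and every visited tip `t_k` satisfies `RC ω (b_k) ∧ hair_k ∈ ω`;
* `HairyCycle.reachable_cyc_of_RC`, `HairyCycle.reachable_tip_of_RT` — conversely these conditions give open walks;
* `HairyCycle.mem_openConn_tip_iff` — **`o ↔ t_k` iff `(clockwise arc to c_{b_k} open ∨ counter-clockwise arc open) ∧ hair_k open`**,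
  `HairyCycle.mem_openConn_cyc_iff` — the same for cycle vertices.
Data in plain `ℕ`-indexed form (`cyc : ℕ → Fin n` injective below `L ≥ 3`, `base k < L`, `tip : ℕ → Fin n` injective below `K`, tips off the
cycle); cycle edge `e_i = s(c_i, c_{(i+1) mod L})`, hair edge `s(c_{b_k}, t_k)`.  No measure theory here; no sorries; standard axioms.
[cite: KozmaNitzan2024, Conjecture 3 (p. 15)] (context: the lower-tail programme); elementary graph theory otherwise [this work].
-/

namespace Summit.CriticalPhenomena.PercolationContinuityZ3.Theorems.HairyCycle

open Finset
open Literature.Probability.Percolation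

variable {n : ℕ}

/-! ## The data of a hairy cycle and its edges -/

/-- The `i`-th cycle edge `s(c_i, c_{(i+1) mod L})`. [this work] -/
def cycE (L : ℕ) (cyc : ℕ → Fin n) (i : ℕ) : Sym2 (Fin n) := s(cyc i, cyc ((i + 1) % L))

/-- The `k`-th hair edge `s(c_{b_k}, t_k)`. [this work] -/
def hairE (cyc : ℕ → Fin n) (base : ℕ → ℕ) (tip : ℕ → Fin n) (k : ℕ) : Sym2 (Fin n) := s(cyc (base k), tip k)

/-- A configuration is CARRIED by the hairy cycle if every open non-loop pair is a cycle edge or a hair edge. [this work] -/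
def Carried (L : ℕ) (cyc : ℕ → Fin n) (K : ℕ) (base : ℕ → ℕ) (tip : ℕ → Fin n) (ω : Set (Sym2 (Fin n))) : Prop :=
  ∀ u v : Fin n, u ≠ v → s(u, v) ∈ ω → (∃ i, i < L ∧ s(u, v) = cycE L cyc i) ∨ (∃ k, k < K ∧ s(u, v) = hairE cyc base tip k)

/-- Clockwise arc to position `i` open: cycle edges `e_0, …, e_{i−1}`. [this work] -/
def CW (L : ℕ) (cyc : ℕ → Fin n) (ω : Set (Sym2 (Fin n))) (i : ℕ) : Prop := ∀ m, m < i → cycE L cyc m ∈ ω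

/-- Counter-clockwise arc to position `i` open: cycle edges `e_i, …, e_{L−1}`. [this work] -/
def CCW (L : ℕ) (cyc : ℕ → Fin n) (ω : Set (Sym2 (Fin n))) (i : ℕ) : Prop := ∀ m, i ≤ m → m < L → cycE L cyc m ∈ ω

/-- Position `i` is reached along an arc. [this work] -/
def RC (L : ℕ) (cyc : ℕ → Fin n) (ω : Set (Sym2 (Fin n))) (i : ℕ) : Prop := CW L cyc ω i ∨ CCW L cyc ω i

/-- Tip `k` is reached: its base along an arc and its hair open. [this work] -/
def RT (L : ℕ) (cyc : ℕ → Fin n) (base : ℕ → ℕ) (tip : ℕ → Fin n) (ω : Set (Sym2 (Fin n))) (k : ℕ) : Prop :=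
  RC L cyc ω (base k) ∧ hairE cyc base tip k ∈ ω

section Structure

variable (L : ℕ) (cyc : ℕ → Fin n) (K : ℕ) (base : ℕ → ℕ) (tip : ℕ → Fin n)
  (hL : 3 ≤ L) (hcyc : ∀ i j, i < L → j < L → cyc i = cyc j → i = j)
  (hbase : ∀ k, k < K → base k < L) (htip : ∀ k k', k < K → k' < K → tip k = tip k' → k = k')
  (hoff : ∀ k i, k < K → i < L → tip k ≠ cyc i)
include hL hcyc

/-- Endpoints of a cycle edge, as an unordered pair of positions: if `s(c_a, c_b) = e_i` with `a, b < L` then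
`(a = i ∧ b = (i+1) mod L) ∨ (a = (i+1) mod L ∧ b = i)`. [this work] -/
theorem cycE_eq_iff {a b i : ℕ} (ha : a < L) (hb : b < L) (hi : i < L) (h : s(cyc a, cyc b) = cycE L cyc i) :
    (a = i ∧ b = (i + 1) % L) ∨ (a = (i + 1) % L ∧ b = i) := by
  have hi1 : (i + 1) % L < L := Nat.mod_lt _ (by omega)
  unfold cycE at h
  rcases Sym2.eq_iff.1 h with ⟨h1, h2⟩ | ⟨h1, h2⟩
  · exact Or.inl ⟨hcyc _ _ ha hi h1, hcyc _ _ hb hi1 h2⟩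
  · exact Or.inr ⟨hcyc _ _ ha hi1 h1, hcyc _ _ hb hi h2⟩

omit hL hcyc in
/-- Position `0` is always reached (empty clockwise arc). [this work] -/
theorem RC_zero (ω : Set (Sym2 (Fin n))) : RC L cyc ω 0 := Or.inl fun m hm => absurd hm (Nat.not_lt_zero m)

omit hL hcyc in
/-- One clockwise step: `RC i` and `e_i` open give `RC (i+1)`. [this work] -/
theorem RC_succ {ω : Set (Sym2 (Fin n))} {i : ℕ} (h : RC L cyc ω i) (he : cycE L cyc i ∈ ω) : RC L cyc ω (i + 1) := by
  rcases h with h | h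
  · left
    intro m hm
    rcases Nat.lt_succ_iff_lt_or_eq.1 hm with hm | rfl
    · exact h m hm
    · exact he
  · right
    intro m hm hmL
    exact h m (by omega) hmL

omit hL hcyc in
/-- One counter-clockwise step: `RC (i+1)`, `e_i` open give `RC i`. [this work] -/
theorem RC_pred {ω : Set (Sym2 (Fin n))} {i : ℕ} (h : RC L cyc ω (i + 1)) (he : cycE L cyc i ∈ ω) : RC L cyc ω i := by
  rcases h with h | h
  · left
    intro m hm
    exact h m (by omega)
  · right
    intro m hm hmL
    rcases Nat.eq_or_lt_of_le hm with rfl | hm'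
    · exact he
    · exact h m (by omega) hmL

omit hcyc in
/-- The last position from the last edge: `e_{L−1}` open gives `RC (L−1)`. [this work] -/
theorem RC_last {ω : Set (Sym2 (Fin n))} (he : cycE L cyc (L - 1) ∈ ω) : RC L cyc ω (L - 1) := by
  right
  intro m hm hmL
  have : m = L - 1 := by omega
  subst this
  exact he

include hbase htip hoff

/-- **Walk invariant of a carried configuration.**  Along an open walk, the property "the vertex is a cycle vertex `c_i` with `RC i`,
or a tip `t_k` with `RC (b_k)` and hair `k` open" propagates from the start to the end. [this work] -/
theorem openWalk_invariant (ω : Set (Sym2 (Fin n))) (hω : Carried L cyc K base tip ω) :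
    ∀ (u v : Fin n) (p : (openGraph ω).Walk u v),
      ((∃ i, i < L ∧ u = cyc i ∧ RC L cyc ω i) ∨ (∃ k, k < K ∧ u = tip k ∧ RT L cyc base tip ω k)) →
      ((∃ i, i < L ∧ v = cyc i ∧ RC L cyc ω i) ∨ (∃ k, k < K ∧ v = tip k ∧ RT L cyc base tip ω k)) := by
  intro u v p
  induction p with
  | nil => exact id
  | cons hadj p' ih =>
    rename_i u' x v'
    intro hu
    apply ih
    rw [openGraph_adj] at hadj
    obtain ⟨hmem, hux⟩ := hadj
    have hL0 : 0 < L := by omega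
    rcases hω u' x hux hmem with ⟨i, hi, he⟩ | ⟨k, hk, he⟩
    · -- a cycle edge `e_i`: both ends are cycle vertices
      have hi1 : (i + 1) % L < L := Nat.mod_lt _ hL0
      -- `u'` is a cycle vertex with `RC`
      have hends : (u' = cyc i ∧ x = cyc ((i + 1) % L)) ∨ (u' = cyc ((i + 1) % L) ∧ x = cyc i) := by
        unfold cycE at he
        rcases Sym2.eq_iff.1 he with ⟨h1, h2⟩ | ⟨h1, h2⟩
        · exact Or.inl ⟨h1, h2⟩
        · exact Or.inr ⟨h1, h2⟩
      have hRCu : ∀ a, a < L → u' = cyc a → RC L cyc ω a := by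
        intro a ha hua
        rcases hu with ⟨i', hi', hu', hRC⟩ | ⟨k', hk', hu', -⟩
        · rw [hcyc _ _ hi' ha (hu'.symm.trans hua)] at hRC; exact hRC
        · exact absurd (hu'.symm.trans hua) (hoff k' a hk' ha)
      left
      rcases hends with ⟨hu1, hx1⟩ | ⟨hu1, hx1⟩
      · -- step `c_i → c_{i+1}`
        refine ⟨(i + 1) % L, hi1, hx1, ?_⟩
        have hRCi := hRCu i hi hu1
        by_cases hlt : i + 1 < L
        · rw [Nat.mod_eq_of_lt hlt]; exact RC_succ L cyc hRCi (he ▸ hmem)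
        · have : i + 1 = L := by omega
          rw [this, Nat.mod_self]; exact RC_zero L cyc ω
      · -- step `c_{i+1} → c_i`
        refine ⟨i, hi, hx1, ?_⟩
        by_cases hlt : i + 1 < L
        · have hRCi1 := hRCu (i + 1) hlt (by rw [hu1, Nat.mod_eq_of_lt hlt])
          exact RC_pred L cyc hRCi1 (he ▸ hmem)
        · have hiL : i = L - 1 := by omega
          subst hiL
          exact RC_last L cyc hL (he ▸ hmem)
    · -- a hair edge: one end is the base, the other the tip
      have hbk := hbase k hk
      unfold hairE at he
      rcases Sym2.eq_iff.1 he with ⟨hu1, hx1⟩ | ⟨hu1, hx1⟩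
      · -- step `base → tip`
        right
        refine ⟨k, hk, hx1, ?_, ?_⟩
        · rcases hu with ⟨i', hi', hu', hRC⟩ | ⟨k', hk', hu', -⟩
          · rw [hcyc _ _ hi' hbk (hu'.symm.trans hu1)] at hRC; exact hRC
          · exact absurd (hu'.symm.trans hu1) (hoff k' _ hk' hbk)
        · unfold hairE; exact he ▸ hmem
      · -- step `tip → base`
        left
        refine ⟨base k, hbk, hx1, ?_⟩
        rcases hu with ⟨i', hi', hu', -⟩ | ⟨k', hk', hu', hRT⟩
        · exact absurd (hu1.symm.trans hu') (hoff k i' hk hi')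
        · rw [htip _ _ hk' hk (hu'.symm.trans hu1)] at hRT; exact hRT.1

omit hL hbase htip hoff in
/-- **An open clockwise arc connects.** [this work] -/
theorem reachable_of_CW (ω : Set (Sym2 (Fin n))) : ∀ i, i < L → CW L cyc ω i → (openGraph ω).Reachable (cyc 0) (cyc i) := by
  intro i
  induction i with
  | zero => intro _ _; exact SimpleGraph.Reachable.refl _
  | succ i ih =>
    intro hi h
    have hreach : (openGraph ω).Reachable (cyc 0) (cyc i) := ih (by omega) fun m hm => h m (by omega)
    have hadj : (openGraph ω).Adj (cyc i) (cyc (i + 1)) := by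
      rw [openGraph_adj]
      refine ⟨?_, fun heq => by have := hcyc _ _ (by omega) hi heq; omega⟩
      have := h i (Nat.lt_succ_self i)
      unfold cycE at this
      rwa [Nat.mod_eq_of_lt hi] at this
    exact hreach.trans hadj.reachable

omit hbase htip hoff in
/-- **An open counter-clockwise arc connects.** [this work] -/
theorem reachable_of_CCW (ω : Set (Sym2 (Fin n))) :
    ∀ d i, i < L → i + d = L → CCW L cyc ω i → (openGraph ω).Reachable (cyc 0) (cyc i) := by
  intro d
  induction d with
  | zero => intro i hi hd; omega
  | succ d ih =>
    intro i hi hd h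
    -- the edge `e_i` joins `c_i` to `c_{(i+1) mod L}`, which is reached by induction (or is `c_0`)
    have he : cycE L cyc i ∈ ω := h i le_rfl hi
    have hadj : (openGraph ω).Adj (cyc ((i + 1) % L)) (cyc i) := by
      rw [openGraph_adj]
      refine ⟨?_, fun heq => ?_⟩
      · unfold cycE at he; rw [Sym2.eq_swap]; exact he
      · have := hcyc _ _ (Nat.mod_lt _ (by omega)) hi heq
        by_cases hlt : i + 1 < L
        · rw [Nat.mod_eq_of_lt hlt] at this; omega
        · have h1 : i + 1 = L := by omega
          rw [h1, Nat.mod_self] at this; omega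
    by_cases hlt : i + 1 < L
    · have hreach : (openGraph ω).Reachable (cyc 0) (cyc (i + 1)) :=
        ih (i + 1) hlt (by omega) fun m hm hmL => h m (by omega) hmL
      rw [Nat.mod_eq_of_lt hlt] at hadj
      exact hreach.trans hadj.reachable
    · have h1 : i + 1 = L := by omega
      rw [h1, Nat.mod_self] at hadj
      exact hadj.reachable

omit hbase htip hoff in
/-- `RC i` connects `c_0` to `c_i`. [this work] -/
theorem reachable_cyc_of_RC (ω : Set (Sym2 (Fin n))) {i : ℕ} (hi : i < L) (h : RC L cyc ω i) :
    (openGraph ω).Reachable (cyc 0) (cyc i) := by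
  rcases h with h | h
  · exact reachable_of_CW L cyc hcyc ω i hi h
  · exact reachable_of_CCW L cyc hL hcyc ω (L - i) i hi (by omega) h

omit htip in
/-- `RT k` connects `c_0` to the tip `t_k`. [this work] -/
theorem reachable_tip_of_RT (ω : Set (Sym2 (Fin n))) {k : ℕ} (hk : k < K) (h : RT L cyc base tip ω k) :
    (openGraph ω).Reachable (cyc 0) (tip k) := by
  have h1 := reachable_cyc_of_RC L cyc hL hcyc ω (hbase k hk) h.1
  have hadj : (openGraph ω).Adj (cyc (base k)) (tip k) := by
    rw [openGraph_adj]
    exact ⟨h.2, fun heq => hoff k _ hk (hbase k hk) heq.symm⟩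
  exact h1.trans hadj.reachable

/-- **Reachability of a tip in a carried configuration: `o ↔ t_k ⟺ RT k`.** [this work] -/
theorem mem_openConn_tip_iff (ω : Set (Sym2 (Fin n))) (hω : Carried L cyc K base tip ω) {k : ℕ} (hk : k < K) :
    ω ∈ openConn (cyc 0) (tip k) ↔ RT L cyc base tip ω k := by
  constructor
  · intro h
    obtain ⟨p⟩ := (h : (openGraph ω).Reachable (cyc 0) (tip k))
    rcases openWalk_invariant L cyc K base tip hL hcyc hbase htip hoff ω hω _ _ p
        (Or.inl ⟨0, by omega, rfl, RC_zero L cyc ω⟩) with ⟨i, hi, hti, -⟩ | ⟨k', hk', htk, hRT⟩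
    · exact absurd hti (hoff k i hk hi)
    · rw [htip _ _ hk hk' htk]; exact hRT
  · exact fun h => reachable_tip_of_RT L cyc K base tip hL hcyc hbase hoff ω hk h

/-- **Reachability of a cycle vertex in a carried configuration: `o ↔ c_i ⟺ RC i`.** [this work] -/
theorem mem_openConn_cyc_iff (ω : Set (Sym2 (Fin n))) (hω : Carried L cyc K base tip ω) {i : ℕ} (hi : i < L) :
    ω ∈ openConn (cyc 0) (cyc i) ↔ RC L cyc ω i := by
  constructor
  · intro h
    obtain ⟨p⟩ := (h : (openGraph ω).Reachable (cyc 0) (cyc i))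
    rcases openWalk_invariant L cyc K base tip hL hcyc hbase htip hoff ω hω _ _ p
        (Or.inl ⟨0, by omega, rfl, RC_zero L cyc ω⟩) with ⟨i', hi', hci, hRC⟩ | ⟨k', hk', hck, -⟩
    · rw [hcyc _ _ hi hi' hci]; exact hRC
    · exact absurd hck.symm (hoff k' i hk' hi)
  · exact fun h => reachable_cyc_of_RC L cyc hL hcyc ω hi h

end Structure

end Summit.CriticalPhenomena.PercolationContinuityZ3.Theorems.HairyCycle
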